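import Summits.Ventures.GridStability.Models.WSCC9DAEHessianData
import HarnessLib

/-!
# GridStability/Models/WSCC9DAEHessianCert — «WSCC9-DAE»: the in-kernel `LDLᵀ` certificate of the pinned
# 20×20 Gram matrix of the second variation of the printed energy at the typed operating point:
# `H_pin ≻ 0`, `λ_min(H_pin) ≥ 1/2` (CERTIFIED column)

LADDER-GRIDFUSION G3/G2, seat gridfusion-model-2 (g9); `plan/MODEL-VALIDITY.md` row **MV-4** (c).
Data: `WSCC9DAEHessianData.lean` (`tables`, `pinIdx`, the literal `pinnedHessianQ`, entry checks rows
0–9). Here: the entry checks rows 10–19 (≈ 100 kernel-s), the assembled `pinnedHessianQ_eq` (the literal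
IS `tables.matrix.submatrix pinIdx pinIdx`), and ONE `decide +kernel` running the exact symmetric
elimination of `pinnedHessianQ − ½·1` (`Literature.Computation.Certificates.PSD.LDLCertPD`,
[cite: BlekhermanParriloThomas2012, App. A.1.2]; pivots are exact rationals of up to ≈ 700 digits;
measured ≈ 5 kernel-s), transported to the formula matrix. Consequences: `WSCC9DAELocalMin.lean`.
VALIDATED cross-checks (docstring only): float `λ_min(H_pin) ≈ 0.663`, so the margin `1/2` passes at the
first attempt (`K = 0`); the unpinned 21×21 matrix has the single rotational zero mode (`H·𝟙 = 0`).
THREE COLUMNS: CERTIFIED = the kernel `decide`; MODELLED = MV-4 instance «WSCC9-DAE»; no sentence about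
the WSCC system.
-/

noncomputable section

open Finset
open Summit.Ventures.GridStability.Models.StructurePreservingDAE
open Literature.Computation.Certificates

namespace Summit.Ventures.GridStability.Models.WSCC9DAE

set_option maxHeartbeats 0 in
/-- Kernel check, rows 10–14. [folklore] -/
theorem pinnedHessianQ_eq_block2 : ∀ i j : Fin 20, 10 ≤ i.val → i.val < 15 →
    (tables.matrix.submatrix pinIdx pinIdx) i j = pinnedHessianQ i j := by
  decide +kernel

set_option maxHeartbeats 0 in
/-- Kernel check, rows 15–19. [folklore] -/
theorem pinnedHessianQ_eq_block3 : ∀ i j : Fin 20, 15 ≤ i.val →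
    (tables.matrix.submatrix pinIdx pinIdx) i j = pinnedHessianQ i j := by
  decide +kernel

/-- **The literal IS the pinned Gram matrix of the rational tables** (all 400 entries, assembled from
the four kernel-checked row blocks). [cite: Padiyar2013, §3.4.4 eq (3.32)] -/
theorem pinnedHessianQ_eq : tables.matrix.submatrix pinIdx pinIdx = pinnedHessianQ := by
  refine Matrix.ext fun i j => ?_
  by_cases h5 : i.val < 5
  · exact pinnedHessianQ_eq_block0 i j h5
  by_cases h10 : i.val < 10
  · exact pinnedHessianQ_eq_block1 i j (by omega) h10
  by_cases h15 : i.val < 15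
  · exact pinnedHessianQ_eq_block2 i j (by omega) h15
  · exact pinnedHessianQ_eq_block3 i j (by omega)

set_option maxHeartbeats 0 in
/-- `LDLᵀ` certificate of the literal with margin `1/2`: exact symmetric elimination of
`pinnedHessianQ − ½·1` IN THE KERNEL, all pivots positive. [cite: BlekhermanParriloThomas2012, App. A.1.2] -/
theorem pinnedHessianQ_ldlCertPD : PSD.LDLCertPD pinnedHessianQ 0 (1 / 2) := by
  decide +kernel

/-- **THE CERTIFICATE** (CERTIFIED column): the pinned 20×20 Gram matrix of the second variation of
the printed energy at the typed operating point of «WSCC9-DAE» carries the in-kernel `LDLᵀ`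
positive-definiteness certificate with margin `1/2` — `H_pin ≻ 0`, `λ_min(H_pin) ≥ 1/2`.
[cite: BlekhermanParriloThomas2012, App. A.1.2]; [cite: Padiyar2013, §3.4.4 eq (3.32)] -/
theorem pinnedHessian_ldlCertPD :
    PSD.LDLCertPD (tables.matrix.submatrix pinIdx pinIdx) 0 (1 / 2) := by
  rw [pinnedHessianQ_eq]
  exact pinnedHessianQ_ldlCertPD

/-- The pinned Gram matrix, cast to `ℝ`, is positive definite (for referee replay).
[cite: BlekhermanParriloThomas2012, App. A.1.2] -/
theorem pinnedHessian_posDef :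
    ((tables.matrix.submatrix pinIdx pinIdx).map (Rat.cast : ℚ → ℝ)).PosDef :=
  pinnedHessian_ldlCertPD.posDef

/-- The certified margin as a number: `½ Σ xᵢ² ≤ xᵀ H_pin x` for every real `x`
(`pdMargin … 0 (1/2) = 1/2` by definition of the search with `K = 0`). [cite: BlekhermanParriloThomas2012, App. A.1.2] -/
theorem pinnedHessian_quadForm_ge (x : Fin 20 → ℝ) :
    ((PSD.pdMargin (tables.matrix.submatrix pinIdx pinIdx) 0 (1 / 2) : ℚ) : ℝ) * ∑ i, x i ^ 2
      ≤ ∑ i, ∑ j, x i * ((tables.matrix.submatrix pinIdx pinIdx) i j : ℝ) * x j :=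
  pinnedHessian_ldlCertPD.quadForm_ge x

end Summit.Ventures.GridStability.Models.WSCC9DAE

end
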